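import Literature.Analysis.Complex.LengthAreaUniform
import Literature.Probability.RandomPlanarGeometry.LoewnerInverse
import Literature.Probability.RandomPlanarGeometry.RadialChordalMoebius

/-!
# `stub_gate` — a uniform Wolff gate in a chordal Loewner chain (crux `PathUpgradeR`,
stmt-CriticalPhenomena-18055, route `SAWReversalUpgrade`, line `bidir_windows`)

Landing target:
`Summits/CriticalPhenomena/SAWScalingLimit/Theorems/SAWReversalUpgradePathUpgradeRGate.lean`
(`--supports stmt-CriticalPhenomena-18055`; registered stub `stub_gate` of
`Cruxes/PathUpgradeR/Lines/bidir_windows.lean`, statement verbatim).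

**Theorem.** For `M, λ, R_out > 0` there is `r₁ > 0` (depending on nothing else) such that for
every Dobrushin domain `E ⊆ B(c, M)` with uniformizer `ψ : ℍ → E`, every continuous driving
function `U` and every time `t₁`, the domain `ψ (ℍ ∖ K_{t₁}) = ψ '' (Loewner.domain U t₁)` splits
as `P ⊔ Q ⊔ C` where `C` has Euclidean diameter `≤ λ`, every preconnected subset of `P ∪ Q` lies
in `P` or in `Q`, the image under `ψ ∘ f_{t₁}` of the conformal `r₁`-neighbourhood
`{y ∈ ℍ : |y - U t₁| ≤ r₁}` of the tip lies in `P`, and the image of `{y ∈ ℍ : |y - U t₁| ≥ R_out}`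
lies in `Q`.

**Proof.** Put `x₀ = U t₁` and consider the dilated Cayley map `Cay z = x₀ + R_out · toHalf z`
(`toHalf z = i (1 - z)/(1 + z)`, tree file `RadialChordalMoebius`) of the unit disc `𝔻` onto `ℍ`
with `Cay 1 = x₀`, inverse `Inv w = toDisc ((w - x₀)/R_out)`. The map
`f = ψ ∘ f_{t₁} ∘ Cay : 𝔻 → E ⊆ B(c, M)` is univalent (`LoewnerFlow`: `f_{t₁} = g_{t₁}⁻¹` is
holomorphic and injective on `ℍ`), so the uniform Wolff lemma of the tree
(`LengthArea.exists_radius_forall_short_crosscut_of_subset_ball`, Pommerenke (1992) Prop. 2.2/2.3)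
with `ε = λ/2` at `ζ = 1` gives a radius `r ∈ (r₀, λ/2]`, `r₀ = r₀(M, λ) ∈ (0, 1)` chosen BEFORE
`f`, such that the crosscut `f (𝔻 ∩ {|z - 1| = r})` lies within `λ/2` of one point. With the
continuous inverse `G = Inv ∘ g_{t₁} ∘ ψ⁻¹` of `f` on `ψ '' (domain U t₁)` put
`P = {G ∈ B(1, r)}`, `Q = {G ∉ B̄(1, r)}`, `C = {|G - 1| = r}` (all inside `ψ '' domain`):
disjointness and the union are set algebra, a preconnected `S ⊆ P ∪ Q` has preconnected image
`G '' S` inside the two separating open sets `B(1, r)`, `B̄(1, r)ᶜ`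
(`IsPreconnected.subset_or_subset`), and `G (ψ (f_{t₁} y)) = toDisc ((y - x₀)/R_out)` with
`|toDisc v - 1| = 2|v|/|i + v|`, which is `≤ 2|v| ≤ r₀ < r` for `|y - x₀| ≤ r₁ := R_out r₀ / 2`
and `≥ 1 > r` for `|y - x₀| ≥ R_out`. [folklore]
-/

noncomputable section

open Set Filter Metric Topology Complex
open UpperHalfPlane (upperHalfPlaneSet isOpen_upperHalfPlaneSet)
open scoped NNReal
open Literature.Probability.RandomPlanarGeometry
open Literature.Probability.RandomPlanarGeometry.RadialChordal
open Literature.Analysis.Complex.LengthArea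

namespace Summit.CriticalPhenomena.SAWScalingLimit.Theorems

namespace PathUpgradeRGate

/-! ### The Cayley-type map `toDisc` near the boundary point `1 = toDisc 0` -/

/-- `toDisc v - 1 = -2v/(i + v)`, in norm. [folklore] -/
theorem norm_toDisc_sub_one {v : ℂ} (hv : I + v ≠ 0) : ‖toDisc v - 1‖ = 2 * ‖v‖ / ‖I + v‖ := by
  have h : toDisc v - 1 = -(2 * v) / (I + v) := by
    rw [toDisc_apply, div_sub_one hv]; ring
  rw [h, norm_div, norm_neg, norm_mul, Complex.norm_two]

/-- For `v ∈ ℍ`: `‖toDisc v - 1‖ ≤ 2 ‖v‖` (since `|i + v| ≥ 1 + im v ≥ 1`). [folklore] -/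
theorem norm_toDisc_sub_one_le {v : ℂ} (hv : 0 < v.im) : ‖toDisc v - 1‖ ≤ 2 * ‖v‖ := by
  have hne : I + v ≠ 0 := I_add_ne_zero hv.le
  rw [norm_toDisc_sub_one hne]
  have h1 : 1 ≤ ‖I + v‖ := by
    calc (1 : ℝ) ≤ |(I + v).im| := by
          rw [add_im, I_im, abs_of_pos (by linarith)]; linarith
      _ ≤ ‖I + v‖ := Complex.abs_im_le_norm _
  exact div_le_self (by positivity) h1

/-- For `v ∈ ℍ` with `‖v‖ ≥ 1`: `‖toDisc v - 1‖ ≥ 1` (since `|i + v| ≤ 1 + |v| ≤ 2|v|`).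
[folklore] -/
theorem one_le_norm_toDisc_sub_one {v : ℂ} (hv : 0 < v.im) (h1 : 1 ≤ ‖v‖) :
    1 ≤ ‖toDisc v - 1‖ := by
  have hne : I + v ≠ 0 := I_add_ne_zero hv.le
  rw [norm_toDisc_sub_one hne, one_le_div (norm_pos_iff.2 hne)]
  calc ‖I + v‖ ≤ ‖I‖ + ‖v‖ := norm_add_le _ _
    _ = 1 + ‖v‖ := by rw [Complex.norm_I]
    _ ≤ 2 * ‖v‖ := by linarith

/-- `toDisc` is continuous at every point off its pole `-i`. [folklore] -/
theorem continuousAt_toDisc {v : ℂ} (hv : I + v ≠ 0) : ContinuousAt toDisc v :=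
  -- adapted from `RadialChordalTrace.continuousAt_toDisc` (heavy imports avoided)
  (continuous_const.sub continuous_id).continuousAt.div
    (continuous_const.add continuous_id).continuousAt hv

/-- `toHalf` is complex differentiable at every point off its pole `-1`. [folklore] -/
theorem differentiableAt_toHalf {z : ℂ} (hz : 1 + z ≠ 0) : DifferentiableAt ℂ toHalf z := by
  have h : DifferentiableAt ℂ (fun w : ℂ ↦ I * (1 - w) / (1 + w)) z :=
    ((differentiableAt_const I).mul ((differentiableAt_const 1).sub differentiableAt_id)).div
      ((differentiableAt_const 1).add differentiableAt_id) hz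
  exact h

/-! ### The dilated Cayley map `z ↦ x₀ + R · toHalf z` and its inverse `w ↦ toDisc ((w - x₀)/R)` -/

/-- The scaled variable `(w - x₀)/R` of a point of `ℍ` lies in `ℍ` (`x₀` real, `R > 0`).
[folklore] -/
theorem im_scale_pos (x₀ : ℝ) {R : ℝ} (hR : 0 < R) {w : ℂ} (hw : 0 < w.im) :
    0 < ((w - x₀) / R).im := by
  rw [div_ofReal_im, sub_im, ofReal_im, sub_zero]
  exact div_pos hw hR

/-- The dilated Cayley map sends the unit disc into `ℍ`. [folklore] -/
theorem im_cay_pos (x₀ : ℝ) {R : ℝ} (hR : 0 < R) {z : ℂ} (hz : ‖z‖ < 1) :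
    0 < ((x₀ : ℂ) + R * toHalf z).im := by
  rw [add_im, ofReal_im, zero_add, im_ofReal_mul]
  exact mul_pos hR (im_toHalf_pos hz)

/-- `Inv ∘ Cay = id` on the unit disc. [folklore] -/
theorem toDisc_scale_cay (x₀ : ℝ) {R : ℝ} (hR : 0 < R) {z : ℂ} (hz : ‖z‖ < 1) :
    toDisc (((x₀ : ℂ) + R * toHalf z - x₀) / R) = z := by
  rw [add_sub_cancel_left, mul_div_cancel_left₀ _ (ofReal_ne_zero.2 hR.ne'),
    toDisc_toHalf (one_add_ne_zero hz)]

/-- `Cay ∘ Inv = id` on `ℍ`. [folklore] -/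
theorem cay_toDisc_scale (x₀ : ℝ) {R : ℝ} (hR : 0 < R) {w : ℂ} (hw : 0 < w.im) :
    (x₀ : ℂ) + R * toHalf (toDisc ((w - x₀) / R)) = w := by
  rw [toHalf_toDisc (I_add_ne_zero (im_scale_pos x₀ hR hw).le), ← mul_div_assoc,
    mul_div_cancel_left₀ _ (ofReal_ne_zero.2 hR.ne')]
  ring

/-- The dilated Cayley map is holomorphic on the unit disc. [folklore] -/
theorem differentiableOn_cay (x₀ R : ℝ) :
    DifferentiableOn ℂ (fun z : ℂ ↦ (x₀ : ℂ) + R * toHalf z) (ball 0 1) := by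
  have h : DifferentiableOn ℂ toHalf (ball 0 1) := fun _ hz ↦
    (differentiableAt_toHalf (one_add_ne_zero (mem_ball_zero_iff.1 hz))).differentiableWithinAt
  exact (h.const_mul (R : ℂ)).const_add (x₀ : ℂ)

/-- The inverse `w ↦ toDisc ((w - x₀)/R)` is continuous on `ℍ`. [folklore] -/
theorem continuousOn_inv (x₀ : ℝ) {R : ℝ} (hR : 0 < R) :
    ContinuousOn (fun w : ℂ ↦ toDisc ((w - x₀) / R)) upperHalfPlaneSet := by
  intro w hw
  have h1 : ContinuousAt (fun w : ℂ ↦ (w - x₀) / R) w := by fun_prop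
  have h2 : ContinuousAt toDisc ((w - x₀) / R) :=
    continuousAt_toDisc (I_add_ne_zero (im_scale_pos x₀ hR hw).le)
  exact (ContinuousAt.comp (f := fun w : ℂ ↦ (w - x₀) / R) (x := w) h2 h1).continuousWithinAt

/-! ### The univalent map `f = ψ ∘ f_{t₁} ∘ Cay` on the disc and its inverse `G` -/

section Chain

variable {E : DobrushinDomain} (ψ : ConformalEquiv upperHalfPlaneSet E.carrier) {U : ℝ≥0 → ℝ}
  {x₀ R : ℝ} {f G : ℂ → ℂ}

/-- `f = ψ ∘ f_{t₁} ∘ Cay` is holomorphic on the unit disc. [folklore] -/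
theorem differentiableOn_f (hU : Continuous U) (t₁ : ℝ≥0) (hR : 0 < R)
    (hf : ∀ z, f z = ψ (Loewner.loewnerInv U t₁ ((x₀ : ℂ) + R * toHalf z))) :
    DifferentiableOn ℂ f (ball 0 1) := by
  have h1 : MapsTo (fun z : ℂ ↦ (x₀ : ℂ) + R * toHalf z) (ball 0 1) upperHalfPlaneSet :=
    fun z hz ↦ im_cay_pos x₀ hR (mem_ball_zero_iff.1 hz)
  have h2 : MapsTo (Loewner.loewnerInv U t₁) upperHalfPlaneSet upperHalfPlaneSet :=
    fun y hy ↦ Loewner.im_loewnerInv_pos hU t₁ hy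
  have h := ((ψ.differentiableOn_coe.comp (Loewner.differentiableOn_invFunOn_map hU t₁) h2).comp
    (differentiableOn_cay x₀ R) h1)
  exact h.congr fun z _ ↦ hf z

/-- `f` maps the unit disc into `E`. [folklore] -/
theorem f_mem (hU : Continuous U) (t₁ : ℝ≥0) (hR : 0 < R)
    (hf : ∀ z, f z = ψ (Loewner.loewnerInv U t₁ ((x₀ : ℂ) + R * toHalf z))) {z : ℂ}
    (hz : ‖z‖ < 1) : f z ∈ E.carrier := by
  rw [hf]
  exact ψ.mapsTo (Loewner.im_loewnerInv_pos hU t₁ (im_cay_pos x₀ hR hz))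

/-- `G ∘ f = id` on the unit disc. [folklore] -/
theorem G_f (hU : Continuous U) (t₁ : ℝ≥0) (hR : 0 < R)
    (hf : ∀ z, f z = ψ (Loewner.loewnerInv U t₁ ((x₀ : ℂ) + R * toHalf z)))
    (hG : ∀ p, G p = toDisc ((Loewner.map U t₁ (ψ.symm p) - x₀) / R)) {z : ℂ} (hz : ‖z‖ < 1) :
    G (f z) = z := by
  have h1 : 0 < ((x₀ : ℂ) + R * toHalf z).im := im_cay_pos x₀ hR hz
  rw [hf, hG, ψ.symm_apply_apply (Loewner.im_loewnerInv_pos hU t₁ h1),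
    Loewner.map_loewnerInv hU t₁ h1, toDisc_scale_cay x₀ hR hz]

/-- `G` on `ψ (H_{t₁})`: `G (ψ w) = toDisc ((g_{t₁} w - x₀)/R)`. [folklore] -/
theorem G_apply {t₁ : ℝ≥0} (hG : ∀ p, G p = toDisc ((Loewner.map U t₁ (ψ.symm p) - x₀) / R)) {w : ℂ}
    (hw : w ∈ Loewner.domain U t₁) : G (ψ w) = toDisc ((Loewner.map U t₁ w - x₀) / R) := by
  rw [hG, ψ.symm_apply_apply (Loewner.domain_subset U t₁ hw)]

/-- `G` at the image of the inverse Loewner map: `G (ψ (f_{t₁} y)) = toDisc ((y - x₀)/R)`.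
[folklore] -/
theorem G_loewnerInv (hU : Continuous U) (t₁ : ℝ≥0)
    (hG : ∀ p, G p = toDisc ((Loewner.map U t₁ (ψ.symm p) - x₀) / R)) {y : ℂ} (hy : 0 < y.im) :
    G (ψ (Loewner.loewnerInv U t₁ y)) = toDisc ((y - x₀) / R) := by
  rw [G_apply ψ hG (Loewner.loewnerInv_mem_domain hU t₁ hy), Loewner.map_loewnerInv hU t₁ hy]

/-- `G` maps `ψ (H_{t₁})` into the unit disc. [folklore] -/
theorem norm_G_lt_one (hU : Continuous U) (t₁ : ℝ≥0) (hR : 0 < R)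
    (hG : ∀ p, G p = toDisc ((Loewner.map U t₁ (ψ.symm p) - x₀) / R)) {w : ℂ}
    (hw : w ∈ Loewner.domain U t₁) : ‖G (ψ w)‖ < 1 := by
  rw [G_apply ψ hG hw]
  exact norm_toDisc_lt_one (im_scale_pos x₀ hR (Loewner.mapsTo_map hU t₁ hw))

/-- `f ∘ G = id` on `ψ (H_{t₁})`. [folklore] -/
theorem f_G (hU : Continuous U) (t₁ : ℝ≥0) (hR : 0 < R)
    (hf : ∀ z, f z = ψ (Loewner.loewnerInv U t₁ ((x₀ : ℂ) + R * toHalf z)))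
    (hG : ∀ p, G p = toDisc ((Loewner.map U t₁ (ψ.symm p) - x₀) / R)) {w : ℂ}
    (hw : w ∈ Loewner.domain U t₁) : f (G (ψ w)) = ψ w := by
  rw [G_apply ψ hG hw, hf, cay_toDisc_scale x₀ hR (Loewner.mapsTo_map hU t₁ hw),
    Loewner.loewnerInv_map hU hw]

/-- `G = Inv ∘ g_{t₁} ∘ ψ⁻¹` is continuous on `ψ (H_{t₁})`. [folklore] -/
theorem continuousOn_G (hU : Continuous U) (t₁ : ℝ≥0) (hR : 0 < R)
    (hG : ∀ p, G p = toDisc ((Loewner.map U t₁ (ψ.symm p) - x₀) / R)) :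
    ContinuousOn G (ψ '' Loewner.domain U t₁) := by
  have h0 : ψ '' Loewner.domain U t₁ ⊆ E.carrier := by
    rintro _ ⟨w, hw, rfl⟩
    exact ψ.mapsTo (Loewner.domain_subset U t₁ hw)
  have h1 : ContinuousOn ψ.symm (ψ '' Loewner.domain U t₁) := ψ.symm.continuousOn.mono h0
  have h1m : MapsTo ψ.symm (ψ '' Loewner.domain U t₁) (Loewner.domain U t₁) := by
    rintro _ ⟨w, hw, rfl⟩
    rw [ψ.symm_apply_apply (Loewner.domain_subset U t₁ hw)]
    exact hw
  have h2 : ContinuousOn (Loewner.map U t₁) (Loewner.domain U t₁) :=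
    (Loewner.differentiableOn_map hU t₁).continuousOn
  have h := (continuousOn_inv x₀ hR).comp (h2.comp h1 h1m) ((Loewner.mapsTo_map hU t₁).comp h1m)
  exact h.congr fun p _ ↦ hG p

end Chain

end PathUpgradeRGate

open PathUpgradeRGate in
/-- **Uniform Wolff gate in a Loewner chain.** For `M, λ, R_out > 0` there is `r₁ > 0` such that
for every Dobrushin domain `E ⊆ B(c, M)` with uniformizer `ψ : ℍ → E`, every continuous driver `U`
and time `t₁`, `ψ (ℍ ∖ K_{t₁})` splits as `P ⊔ Q ⊔ C` with `diam C ≤ λ`, preconnected subsets of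
`P ∪ Q` on one side, `ψ (f_{t₁} {|y - U t₁| ≤ r₁}) ⊆ P` and `ψ (f_{t₁} {|y - U t₁| ≥ R_out}) ⊆ Q`.
Wolff's length–area lemma (Pommerenke (1992), Prop. 2.2/2.3; tree
`LengthArea.exists_radius_forall_short_crosscut_of_subset_ball`) transported by the dilated Cayley
map `z ↦ U t₁ + R_out · i (1 - z)/(1 + z)`. [folklore] -/
theorem stub_gate : ∀ (M lam Rout : ℝ), 0 < M → 0 < lam → 0 < Rout → ∃ r₁ : ℝ, 0 < r₁ ∧ ∀ (E : Literature.Probability.RandomPlanarGeometry.DobrushinDomain) (ψ : Literature.Probability.RandomPlanarGeometry.ConformalEquiv UpperHalfPlane.upperHalfPlaneSet E.carrier) (c : ℂ), E.carrier ⊆ Metric.ball c M → ∀ (U : NNReal → ℝ), Continuous U → ∀ t₁ : NNReal, ∃ C P Q : Set ℂ, (∀ p ∈ C, ∀ q ∈ C, dist p q ≤ lam) ∧ Disjoint P Q ∧ Disjoint P C ∧ Disjoint Q C ∧ P ∪ Q ∪ C = ψ '' (Literature.Probability.RandomPlanarGeometry.Loewner.domain U t₁) ∧ (∀ S : Set ℂ,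 IsPreconnected S → S ⊆ P ∪ Q → S ⊆ P ∨ S ⊆ Q) ∧ (∀ y : ℂ, 0 < y.im → dist y (U t₁) ≤ r₁ → ψ (Literature.Probability.RandomPlanarGeometry.Loewner.loewnerInv U t₁ y) ∈ P) ∧ (∀ y : ℂ, 0 < y.im → Rout ≤ dist y (U t₁) → ψ (Literature.Probability.RandomPlanarGeometry.Loewner.loewnerInv U t₁ y) ∈ Q) := by
  intro M lam Rout hM hlam hRout
  obtain ⟨r₀, ⟨hr₀0, hr₀1⟩, hWolff⟩ :=
    exists_radius_forall_short_crosscut_of_subset_ball (M := M) hM.le (half_pos hlam)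
  refine ⟨Rout * r₀ / 2, by positivity, fun E ψ c hE U hU t₁ ↦ ?_⟩
  -- the univalent map `f = ψ ∘ f_{t₁} ∘ Cay` on `𝔻` and its inverse `G` on `ψ (H_{t₁})`
  obtain ⟨f, hf⟩ : ∃ f : ℂ → ℂ, ∀ z, f z =
      ψ (Loewner.loewnerInv U t₁ (((U t₁ : ℝ) : ℂ) + Rout * toHalf z)) := ⟨_, fun _ ↦ rfl⟩
  obtain ⟨G, hG⟩ : ∃ G : ℂ → ℂ, ∀ p, G p =
      toDisc ((Loewner.map U t₁ (ψ.symm p) - ((U t₁ : ℝ) : ℂ)) / Rout) := ⟨_, fun _ ↦ rfl⟩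
  have hfi : InjOn f (ball 0 1) := fun z₁ hz₁ z₂ hz₂ h ↦ by
    have h' := congrArg G h
    rwa [G_f ψ hU t₁ hRout hf hG (mem_ball_zero_iff.1 hz₁),
      G_f ψ hU t₁ hRout hf hG (mem_ball_zero_iff.1 hz₂)] at h'
  have hfE : f '' ball 0 1 ⊆ ball c M := by
    rintro _ ⟨z, hz, rfl⟩
    exact hE (f_mem ψ hU t₁ hRout hf (mem_ball_zero_iff.1 hz))
  obtain ⟨r, ⟨hr0, hr1⟩, hr₀r, -, a, -, -, -, hdist, -⟩ :=
    hWolff f c 1 (differentiableOn_f ψ hU t₁ hRout hf) hfi hfE norm_one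
  refine ⟨ψ '' Loewner.domain U t₁ ∩ G ⁻¹' sphere 1 r, ψ '' Loewner.domain U t₁ ∩ G ⁻¹' ball 1 r,
    ψ '' Loewner.domain U t₁ ∩ G ⁻¹' (closedBall 1 r)ᶜ, ?_, ?_, ?_, ?_, ?_, ?_, ?_, ?_⟩
  · -- the crosscut `C = f (𝔻 ∩ {|z - 1| = r})` lies within `λ/2` of the endpoint `a`
    have key : ∀ p ∈ ψ '' Loewner.domain U t₁ ∩ G ⁻¹' sphere 1 r, dist p a ≤ lam / 2 := by
      rintro _ ⟨⟨w, hw, rfl⟩, hps⟩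
      have hps' : G (ψ w) ∈ sphere 1 r := hps
      have hsph : ‖G (ψ w) - 1‖ = r := mem_sphere_iff_norm.1 hps'
      obtain ⟨t, ht, hteq⟩ := exists_eq_cpt (ζ := 1) norm_one hr0 hsph
      have htabs : |t| < Real.arccos (r / 2) :=
        (mem_ball_cpt_iff_abs_lt (ζ := 1) norm_one hr0 (by linarith) (abs_le.2 ⟨ht.1.le, ht.2⟩)).1
          (hteq ▸ mem_ball_zero_iff.2 (norm_G_lt_one ψ hU t₁ hRout hG hw))
      have h := hdist t (abs_lt.1 htabs)
      rwa [← hteq, f_G ψ hU t₁ hRout hf hG hw] at h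
    intro p hp q hq
    calc dist p q ≤ dist p a + dist q a := dist_triangle_right p q a
      _ ≤ lam / 2 + lam / 2 := add_le_add (key p hp) (key q hq)
      _ = lam := add_halves lam
  · exact disjoint_left.2 fun p hP hQ ↦
      (hQ.2 : G p ∈ (closedBall 1 r)ᶜ) (ball_subset_closedBall (hP.2 : G p ∈ ball 1 r))
  · exact disjoint_left.2 fun p hP hC ↦
      (mem_ball.1 (hP.2 : G p ∈ ball 1 r)).ne (mem_sphere.1 (hC.2 : G p ∈ sphere 1 r))
  · exact disjoint_left.2 fun p hQ hC ↦
      (hQ.2 : G p ∈ (closedBall 1 r)ᶜ) (sphere_subset_closedBall (hC.2 : G p ∈ sphere 1 r))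
  · -- `P ∪ Q ∪ C = ψ (H_{t₁})`
    ext p
    simp only [mem_union, mem_inter_iff, mem_preimage, mem_ball, mem_compl_iff, mem_closedBall,
      not_le, mem_sphere]
    constructor
    · rintro ((⟨h, -⟩ | ⟨h, -⟩) | ⟨h, -⟩) <;> exact h
    · intro hp
      rcases lt_trichotomy (dist (G p) 1) r with h | h | h
      · exact Or.inl (Or.inl ⟨hp, h⟩)
      · exact Or.inr ⟨hp, h⟩
      · exact Or.inl (Or.inr ⟨hp, h⟩)
  · -- preconnected subsets of `P ∪ Q`: pull back by the continuous `G`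
    intro S hS hSPQ
    have hSsub : S ⊆ ψ '' Loewner.domain U t₁ := fun s hs ↦ (hSPQ hs).elim And.left And.left
    have hGS : G '' S ⊆ ball 1 r ∪ (closedBall 1 r)ᶜ := by
      rintro _ ⟨s, hs, rfl⟩
      rcases hSPQ hs with h | h
      · exact Or.inl h.2
      · exact Or.inr h.2
    have hdisj : Disjoint (ball (1 : ℂ) r) (closedBall 1 r)ᶜ :=
      disjoint_compl_right.mono_left ball_subset_closedBall
    rcases (hS.image G ((continuousOn_G ψ hU t₁ hRout hG).mono hSsub)).subset_or_subset
        isOpen_ball isClosed_closedBall.isOpen_compl hdisj hGS with h | h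
    · exact Or.inl fun s hs ↦ ⟨hSsub hs, h (mem_image_of_mem G hs)⟩
    · exact Or.inr fun s hs ↦ ⟨hSsub hs, h (mem_image_of_mem G hs)⟩
  · -- the conformal `r₁`-neighbourhood of the tip lies in `P`
    intro y hy hyd
    refine ⟨mem_image_of_mem _ (Loewner.loewnerInv_mem_domain hU t₁ hy), ?_⟩
    show G (ψ (Loewner.loewnerInv U t₁ y)) ∈ ball 1 r
    rw [G_loewnerInv ψ hU t₁ hG hy, mem_ball, dist_eq_norm]
    refine (norm_toDisc_sub_one_le (im_scale_pos _ hRout hy)).trans_lt ?_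
    rw [norm_div, Complex.norm_of_nonneg hRout.le, ← dist_eq_norm]
    have h : dist y (U t₁) / Rout ≤ r₀ / 2 := by
      rw [div_le_iff₀ hRout]; linarith
    linarith
  · -- conformal distance `≥ R_out` from the tip lies in `Q`
    intro y hy hyd
    refine ⟨mem_image_of_mem _ (Loewner.loewnerInv_mem_domain hU t₁ hy), ?_⟩
    show G (ψ (Loewner.loewnerInv U t₁ y)) ∈ (closedBall 1 r)ᶜ
    rw [G_loewnerInv ψ hU t₁ hG hy, mem_compl_iff, mem_closedBall, not_le, dist_eq_norm]
    refine hr1.trans_le (one_le_norm_toDisc_sub_one (im_scale_pos _ hRout hy) ?_)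
    rw [norm_div, Complex.norm_of_nonneg hRout.le, le_div_iff₀ hRout, one_mul, ← dist_eq_norm]
    exact hyd

end Summit.CriticalPhenomena.SAWScalingLimit.Theorems

end
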